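import Summits.BirchSwinnertonDyer.Rank1Residual.X11b.Three.JetchevKummerAtP
import Literature.NumberTheory.EllipticCurves.TamagawaSubgroupProofs
import Mathlib.FieldTheory.Galois.Infinite
import HarnessLib

/-!
# X11b at `p = 3` (team N8/O2), JET3-KUMMER help-wanted (d): `E₀` under base change —
# `E₀(L) ∩ E(F) = E₀(F)` and `E₀(L)^{Gal} = ι E₀(F)`

HONEST FRAMING (cell `b2b-bsdres`, run/shared/lean/b2b/bsd-rank1-residual/, verbatim in every
file): the goal of the cell is to DELETE the COMBINATION-SHAPED residual classes of the
Birch–Swinnerton-Dyer formula for ALL analytic-rank `≤ 1` elliptic curves over `ℚ` — "full BSD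
formula for every rank `≤ 1` curve in class `C`" assembled STRICTLY from published theorems — so
that the rank-`≤ 1` remainder becomes exactly the CONSTRUCTION-SHAPED classes, which are TYPED
(missing-input `Prop`s), NOT attempted. This is not "finishing BSD". Team N8/O2 = `x11b3`, seat
`b2b-bsdres-x11b3-p4`, LEAD DEAL #4 (R3/A4.1) row "JET3-KUMMER help-wanted (d) + (α)" for p1's
`X11b/Three/JetchevKummerAtP.lean` (p251610); this is part 1 of 2 (part 2:
`GoodReductionSubgroupGaloisH1.lean` — `hstab`, the reduction of (α), the end form at `v`).
THEOREMS ONLY: no definition, no named fact, no `sorry`; nothing is booked; the flag `JET@p|N` is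
NOT discharged here.

## Setting (p1's dictionary, `JetchevKummerAtP`)

`F = K_v` with valuation ring `R₀` (`IsFractionRing R₀ F`), `L = K[c]_w ⊇ F` with valuation ring
`R` (`IsFractionRing R L`), `R₀ → R` a LOCAL homomorphism compatible with `F → L` (so
`R ∩ F = R₀`: the valuation of `L` restricts to that of `F` — automatic for the rings of integers of
an extension of local fields), `W / F` a Weierstrass equation with `W ⊗ F` `R₀`-minimal and `W ⊗ L`
`R`-minimal (for `L/F` UNRAMIFIED the `v`-minimal equation stays minimal over `L`, Silverman
*AEC* VII.5.4 / Tate's algorithm — here both minimalities are instance hypotheses, exactly as in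
p1's file), `E(F) = (W ⊗ F).Point ↪ E(L) = (W ⊗ L).Point` by Mathlib's `Affine.Point.baseChange F L`
(`ι` below), `E₀ = goodReductionSubgroup` (tree `Tamagawa.lean`; membership =
`IsNonsingularReductionPoint` by the tree theorem `mem_goodReductionSubgroup_iff_holds`),
`D = Gal(L/F) = L ≃ₐ[F] L` acting on `E(L)` coordinatewise (tree instance
`WeierstrassCurve.instDistribMulActionAlgEquivPoint`).

## What is proved

* §1 **(d) `E₀(L) ∩ E(F) = E₀(F)`**: `algebraMap_mem_range_iff` (`x ∈ F` is `R`-integral iff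
  `R₀`-integral: if `x ∉ R₀` then `x⁻¹ ∈ 𝔪_{R₀}` maps into `𝔪_R`), `integralModel_baseChange_eq_map`
  and `reduction_baseChange_eq_map` (the reduced curve of `W ⊗ L` is that of `W ⊗ F` base-changed
  along the residue-field extension `k₀ → k`), `isNonsingularReductionPoint_baseChange_iff`,
  `baseChange_mem_goodReductionSubgroup_iff` (`ι P ∈ E₀(L) ↔ P ∈ E₀(F)`),
  `comap_baseChange_goodReductionSubgroup` (`ι⁻¹ E₀(L) = E₀(F)`),
  `goodReductionSubgroup_inf_range_eq` (`E₀(L) ⊓ ι E(F) = ι E₀(F)`). Proof: nonsingularity of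
  the reduced point is invariant under the injective `k₀ → k` (Mathlib `Affine.map_nonsingular`),
  the same mechanism as the tree's `hasNonsingularReduction_map_adicCompletion_iff`
  (`KodairaNeronProofs`, the case `R → R̂`). Silverman, *AEC* VII.2 (definition of `E₀`).
* §2 **`E₀(L)^D = ι E₀(F)`** for `L/F` Galois: `smul_baseChange` (`ι P` is `D`-fixed),
  `exists_baseChange_eq_of_forall_smul_eq` (a `D`-fixed point comes from `E(F)` — its coordinates
  lie in the fixed field, Mathlib `InfiniteGalois.mem_range_algebraMap_iff_fixed`; the tree's
  `fixedPoints_eq_range_map_holds` is the case `L = F̄`), `forall_smul_eq_iff_exists_baseChange_eq`,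
  `mem_goodReductionSubgroup_iff_exists_of_forall_smul_eq` — the input (d) of `JetchevKummerAtP`
  in p1's form: the `D`-fixed `T₀ ∈ E₀(L)` of `exists_mem_goodReductionSubgroup_add_pow_smul` is
  `ι t₀` with `t₀ ∈ E₀(K_v)`.

References (locators only; no new fact): [cite: SilvermanAEC2009, VII.2 Prop. 2.1 (PDF pp.
166–169), VII.5.4 (PDF p. 175), VIII.§1] [cite: Jetchev2008, Prop. 4.1 (p. 819)]
[cite: GrossLMS1991, Prop. 6.2 (1), pp. 244–245] [cite: NeukirchANT1999, Ch. II §9].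

## Design

No definitions; `noncomputable section`; `open scoped Classical`; universe `u` for `F`, `L` as in
`JetchevKummerAtP`; `R₀`, `R` abstract discrete valuation rings (`Type*`). Axioms: `propext`,
`Classical.choice`, `Quot.sound`.
-/

noncomputable section

open scoped Classical

namespace Summit.BirchSwinnertonDyer.Rank1Residual.X11b.Three.JetchevKummer

open WeierstrassCurve

universe u

/-! ### §1 (d): `E₀` under base change along a local extension of discrete valuation rings -/

section BaseChange

variable {F : Type u} [Field F] (W : WeierstrassCurve F) (L : Type u) [Field L] [Algebra F L]
  (R₀ : Type*) [CommRing R₀] [IsDomain R₀] [IsDiscreteValuationRing R₀] [Algebra R₀ F]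
  [IsFractionRing R₀ F]
  (R : Type*) [CommRing R] [IsDomain R] [IsDiscreteValuationRing R] [Algebra R L]
  [IsFractionRing R L]
  [Algebra R₀ R] [Algebra R₀ L] [IsScalarTower R₀ R L] [IsScalarTower R₀ F L]

omit [IsDomain R] [IsDiscreteValuationRing R] in
/-- **`R ∩ F = R₀`.** For a local homomorphism `R₀ → R` of valuation rings compatible with
`F → L`, an element of `F` is `R`-integral in `L` iff it is `R₀`-integral: if `x ∉ R₀` then
`x⁻¹ ∈ 𝔪_{R₀}` maps into `𝔪_R`, so `x ∉ R`. Neukirch, *ANT* II (the valuation of `L` restricts to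
that of `F`). [folklore] -/
theorem algebraMap_mem_range_iff [IsLocalHom (algebraMap R₀ R)] (x : F) :
    algebraMap F L x ∈ Set.range (algebraMap R L) ↔ x ∈ Set.range (algebraMap R₀ F) := by
  constructor
  · rintro ⟨r, hr⟩
    by_contra hx
    have hx0 : x ≠ 0 := by
      rintro rfl
      exact hx ⟨0, map_zero _⟩
    -- `x ∉ R₀`, so `x⁻¹ ∈ R₀` (valuation ring) and `x⁻¹` is not a unit of `R₀`
    obtain ⟨s, hs⟩ : ∃ s : R₀, algebraMap R₀ F s = x⁻¹ := by
      rcases (ValuationRing.iff_isInteger_or_isInteger R₀ F).mp inferInstance x with h | h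
      · exact (hx (RingHom.mem_rangeS.mp h)).elim
      · exact RingHom.mem_rangeS.mp h
    have hsu : ¬ IsUnit s := by
      rintro ⟨u, rfl⟩
      exact hx ⟨↑u⁻¹, by rw [map_units_inv, hs, inv_inv]⟩
    -- but `r · s = 1` in `R`
    have h1 : algebraMap R L (r * algebraMap R₀ R s) = algebraMap R L 1 := by
      rw [map_mul, hr, ← IsScalarTower.algebraMap_apply, IsScalarTower.algebraMap_apply R₀ F L, hs,
        ← map_mul, mul_inv_cancel₀ hx0, map_one, map_one]
    have hunit : IsUnit (algebraMap R₀ R s) :=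
      IsUnit.of_mul_eq_one_right r (IsFractionRing.injective R L h1)
    exact hsu ((isUnit_map_iff (algebraMap R₀ R) s).mp hunit)
  · rintro ⟨r₀, rfl⟩
    exact ⟨algebraMap R₀ R r₀, by
      rw [← IsScalarTower.algebraMap_apply, IsScalarTower.algebraMap_apply R₀ F L]⟩

omit [IsDomain R₀] [IsDiscreteValuationRing R₀] [IsFractionRing R₀ F] [IsDomain R]
  [IsDiscreteValuationRing R] in
/-- **Integral models are compatible with base change**: Mathlib's chosen `R`-integral model of
`W ⊗ L` is the chosen `R₀`-integral model of `W ⊗ F` with coefficients mapped along `R₀ → R`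
(both base-change to `W ⊗ L`, and `R → L` is injective). [folklore] -/
theorem integralModel_baseChange_eq_map [(W.baseChange F).IsIntegral R₀]
    [(W.baseChange L).IsIntegral R] :
    (W.baseChange L).integralModel R =
      ((W.baseChange F).integralModel R₀).map (algebraMap R₀ R) := by
  apply WeierstrassCurve.map_injective (IsFractionRing.injective R L)
  change ((W.baseChange L).integralModel R).map (algebraMap R L) =
    (((W.baseChange F).integralModel R₀).map (algebraMap R₀ R)).map (algebraMap R L)
  have h1 : ((W.baseChange L).integralModel R).map (algebraMap R L) = W.baseChange L :=
    baseChange_integralModel_eq R (W.baseChange L)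
  have h2 : ((W.baseChange F).integralModel R₀).map (algebraMap R₀ F) = W.baseChange F :=
    baseChange_integralModel_eq R₀ (W.baseChange F)
  rw [h1, WeierstrassCurve.map_map, ← IsScalarTower.algebraMap_eq R₀ R L,
    IsScalarTower.algebraMap_eq R₀ F L, ← WeierstrassCurve.map_map, h2, WeierstrassCurve.baseChange,
    WeierstrassCurve.baseChange, WeierstrassCurve.map_map, Algebra.algebraMap_self, RingHom.comp_id]

/-- **Reduction is compatible with base change**: the reduced curve of the `R`-minimal `W ⊗ L`
is the reduced curve of the `R₀`-minimal `W ⊗ F` with coefficients mapped along the residue-field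
extension `k₀ → k` induced by the local homomorphism `R₀ → R`. Silverman, *AEC* VII.2.
[folklore] -/
theorem reduction_baseChange_eq_map [IsLocalHom (algebraMap R₀ R)]
    [(W.baseChange F).IsMinimal R₀] [(W.baseChange L).IsMinimal R] :
    (W.baseChange L).reduction R =
      ((W.baseChange F).reduction R₀).map (IsLocalRing.ResidueField.map (algebraMap R₀ R)) := by
  have hc : (IsLocalRing.residue R).comp (algebraMap R₀ R) =
      (IsLocalRing.ResidueField.map (algebraMap R₀ R)).comp (IsLocalRing.residue R₀) :=
    RingHom.ext fun r ↦ (IsLocalRing.ResidueField.map_residue (algebraMap R₀ R) r).symm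
  rw [WeierstrassCurve.reduction, WeierstrassCurve.reduction, integralModel_baseChange_eq_map W L R₀ R,
    WeierstrassCurve.map_map, WeierstrassCurve.map_map, hc]

/-- **(d), pointwise: a point of `E(F)` has nonsingular reduction over `L` iff it has over `F`.**
For `P ∈ E(F)` and its image `ι P ∈ E(L)` (`ι = Affine.Point.baseChange F L`): the point at
infinity and the non-integral points correspond (`R ∩ F = R₀`), and an `R₀`-integral point
`(a, b)` reduces to a nonsingular point of `W̃ / k₀` iff it does over the residue field `k ⊇ k₀`
of `R` (nonsingularity is invariant under the injective `k₀ → k`, Mathlib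
`Affine.map_nonsingular`). Silverman, *AEC* VII.2 (definition of `E₀`); used by Gross 1991 p. 244
/ Jetchev 2008 Prop. 4.1 in the form `E₀(L_w) ∩ E(K_v) = E₀(K_v)`. [folklore] -/
theorem isNonsingularReductionPoint_baseChange_iff [IsLocalHom (algebraMap R₀ R)]
    [(W.baseChange F).IsMinimal R₀] [(W.baseChange L).IsMinimal R]
    (P : (W.baseChange F).toAffine.Point) :
    (W.baseChange L).IsNonsingularReductionPoint R
        (Affine.Point.baseChange (W' := W.toAffine) F L P) ↔
      (W.baseChange F).IsNonsingularReductionPoint R₀ P := by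
  rcases P with _ | ⟨x, y, h⟩
  · rw [show (Affine.Point.zero : (W.baseChange F).toAffine.Point) = 0 from rfl, map_zero]
    exact Iff.rfl
  · rw [Affine.Point.map_some]
    change ((Algebra.ofId F L x ∉ Set.range (algebraMap R L)) ∨
        ∃ x₀ y₀ : R, algebraMap R L x₀ = Algebra.ofId F L x ∧ algebraMap R L y₀ = Algebra.ofId F L y ∧
          ((W.baseChange L).reduction R).toAffine.Nonsingular (IsLocalRing.residue R x₀)
            (IsLocalRing.residue R y₀)) ↔
      ((x ∉ Set.range (algebraMap R₀ F)) ∨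
        ∃ x₀ y₀ : R₀, algebraMap R₀ F x₀ = x ∧ algebraMap R₀ F y₀ = y ∧
          ((W.baseChange F).reduction R₀).toAffine.Nonsingular (IsLocalRing.residue R₀ x₀)
            (IsLocalRing.residue R₀ y₀))
    rw [Algebra.ofId_apply, Algebra.ofId_apply]
    have hιR : ∀ a : R₀, algebraMap R L (algebraMap R₀ R a) = algebraMap F L (algebraMap R₀ F a) :=
      fun a ↦ by rw [← IsScalarTower.algebraMap_apply, IsScalarTower.algebraMap_apply R₀ F L]
    refine or_congr (not_congr (algebraMap_mem_range_iff L R₀ R x)) ⟨?_, ?_⟩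
    · rintro ⟨x₀, y₀, hx₀, hy₀, hns⟩
      obtain ⟨a, rfl⟩ := (algebraMap_mem_range_iff L R₀ R x).mp ⟨x₀, hx₀⟩
      obtain ⟨b, rfl⟩ := (algebraMap_mem_range_iff L R₀ R y).mp ⟨y₀, hy₀⟩
      have ha : x₀ = algebraMap R₀ R a := IsFractionRing.injective R L (by rw [hx₀, hιR])
      have hb : y₀ = algebraMap R₀ R b := IsFractionRing.injective R L (by rw [hy₀, hιR])
      refine ⟨a, b, rfl, rfl, ?_⟩
      rw [reduction_baseChange_eq_map W L R₀ R, ha, hb,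
        ← IsLocalRing.ResidueField.map_residue, ← IsLocalRing.ResidueField.map_residue] at hns
      exact (Affine.map_nonsingular _
        (IsLocalRing.ResidueField.map (algebraMap R₀ R)).injective _ _).mp hns
    · rintro ⟨a, b, rfl, rfl, hns⟩
      refine ⟨algebraMap R₀ R a, algebraMap R₀ R b, hιR a, hιR b, ?_⟩
      rw [reduction_baseChange_eq_map W L R₀ R, ← IsLocalRing.ResidueField.map_residue,
        ← IsLocalRing.ResidueField.map_residue]
      exact (Affine.map_nonsingular _
        (IsLocalRing.ResidueField.map (algebraMap R₀ R)).injective _ _).mpr hns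

/-- **(d) `E₀(L) ∩ E(F) = E₀(F)`**: for `P ∈ E(F) = E(K_v)`, `ι P ∈ E₀(L)` iff `P ∈ E₀(F)`
(`L = L_w ⊇ F = K_v`, minimal equations over both valuation rings). This is the input (d) of
`JetchevKummerAtP` ("`E₀(L)^D = E₀(F)`", with §2 below). Silverman, *AEC* VII.2; Jetchev 2008,
proof of Prop. 4.1 (p. 819); Gross 1991, p. 244. [folklore] -/
theorem baseChange_mem_goodReductionSubgroup_iff [IsLocalHom (algebraMap R₀ R)]
    [(W.baseChange F).IsMinimal R₀] [(W.baseChange L).IsMinimal R]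
    (P : (W.baseChange F).toAffine.Point) :
    Affine.Point.baseChange (W' := W.toAffine) F L P ∈ (W.baseChange L).goodReductionSubgroup R ↔
      P ∈ (W.baseChange F).goodReductionSubgroup R₀ := by
  rw [WeierstrassCurve.mem_goodReductionSubgroup_iff_holds R (W.baseChange L)
      (Affine.Point.baseChange (W' := W.toAffine) F L P),
    WeierstrassCurve.mem_goodReductionSubgroup_iff_holds R₀ (W.baseChange F) P]
  exact isNonsingularReductionPoint_baseChange_iff W L R₀ R P

/-- **(d) as an equality of subgroups of `E(F)`**: `ι⁻¹(E₀(L)) = E₀(F)`. [folklore] -/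
theorem comap_baseChange_goodReductionSubgroup [IsLocalHom (algebraMap R₀ R)]
    [(W.baseChange F).IsMinimal R₀] [(W.baseChange L).IsMinimal R] :
    ((W.baseChange L).goodReductionSubgroup R).comap
        (Affine.Point.baseChange (W' := W.toAffine) F L) =
      (W.baseChange F).goodReductionSubgroup R₀ := by
  ext P
  rw [AddSubgroup.mem_comap]
  exact baseChange_mem_goodReductionSubgroup_iff W L R₀ R P

/-- **(d) as an equality of subgroups of `E(L)`**: `E₀(L) ⊓ ι(E(F)) = ι(E₀(F))`. [folklore] -/
theorem goodReductionSubgroup_inf_range_eq [IsLocalHom (algebraMap R₀ R)]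
    [(W.baseChange F).IsMinimal R₀] [(W.baseChange L).IsMinimal R] :
    (W.baseChange L).goodReductionSubgroup R ⊓
        (Affine.Point.baseChange (W' := W.toAffine) F L).range =
      ((W.baseChange F).goodReductionSubgroup R₀).map
        (Affine.Point.baseChange (W' := W.toAffine) F L) := by
  ext Q
  simp only [AddSubgroup.mem_inf, AddMonoidHom.mem_range, AddSubgroup.mem_map]
  constructor
  · rintro ⟨hQ, P, rfl⟩
    exact ⟨P, (baseChange_mem_goodReductionSubgroup_iff W L R₀ R P).mp hQ, rfl⟩
  · rintro ⟨P, hP, rfl⟩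
    exact ⟨(baseChange_mem_goodReductionSubgroup_iff W L R₀ R P).mpr hP, P, rfl⟩

end BaseChange

/-! ### §2 Galois descent: `E(L)^D = ι E(F)` and `E₀(L)^D = ι E₀(F)` -/

section Galois

variable {F : Type u} [Field F] (W : WeierstrassCurve F) (L : Type u) [Field L] [Algebra F L]

/-- Points coming from `F` are fixed by `D = Aut(L/F)`. Silverman, *AEC* VIII.§1. [folklore] -/
theorem smul_baseChange (σ : L ≃ₐ[F] L) (P : (W.baseChange F).toAffine.Point) :
    σ • Affine.Point.baseChange (W' := W.toAffine) F L P =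
      Affine.Point.baseChange (W' := W.toAffine) F L P := by
  rw [WeierstrassCurve.smul_def]
  exact Affine.Point.map_baseChange _ P

/-- **Galois descent for points of a Galois extension**: a point of `E(L)` fixed by every
`σ ∈ Gal(L/F)` comes from `E(F)` (its coordinates lie in the fixed field `F`; Mathlib
`InfiniteGalois.mem_range_algebraMap_iff_fixed`). Silverman, *AEC* VIII.§1
(`H⁰(G_{L/F}, E(L)) = E(F)`). [folklore] -/
theorem exists_baseChange_eq_of_forall_smul_eq [IsGalois F L]
    (Q : (W.baseChange L).toAffine.Point) (hQ : ∀ σ : L ≃ₐ[F] L, σ • Q = Q) :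
    ∃ P : (W.baseChange F).toAffine.Point, Affine.Point.baseChange (W' := W.toAffine) F L P = Q := by
  rcases Q with _ | ⟨x, y, h⟩
  · exact ⟨0, rfl⟩
  · have hxy : ∀ σ : L ≃ₐ[F] L, σ x = x ∧ σ y = y := by
      intro σ
      have := hQ σ
      rw [WeierstrassCurve.smul_def, Affine.Point.map_some] at this
      simpa only [Affine.Point.some.injEq, AlgEquiv.coe_toAlgHom] using this
    obtain ⟨x₀, rfl⟩ := (InfiniteGalois.mem_range_algebraMap_iff_fixed x).mpr fun σ ↦ (hxy σ).1
    obtain ⟨y₀, rfl⟩ := (InfiniteGalois.mem_range_algebraMap_iff_fixed y).mpr fun σ ↦ (hxy σ).2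
    have h₀ : (W.baseChange F).toAffine.Nonsingular x₀ y₀ :=
      (Affine.baseChange_nonsingular W (Algebra.ofId F L).injective x₀ y₀).mp h
    exact ⟨Affine.Point.some x₀ y₀ h₀, rfl⟩

/-- `E(L)^D = ι E(F)` for `L/F` Galois: a point is `Gal(L/F)`-fixed iff it comes from `E(F)`.
Silverman, *AEC* VIII.§1. [folklore] -/
theorem forall_smul_eq_iff_exists_baseChange_eq [IsGalois F L] (Q : (W.baseChange L).toAffine.Point) :
    (∀ σ : L ≃ₐ[F] L, σ • Q = Q) ↔
      ∃ P : (W.baseChange F).toAffine.Point, Affine.Point.baseChange (W' := W.toAffine) F L P = Q := by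
  refine ⟨exists_baseChange_eq_of_forall_smul_eq W L Q, ?_⟩
  rintro ⟨P, rfl⟩ σ
  exact smul_baseChange W L σ P

variable (R₀ : Type*) [CommRing R₀] [IsDomain R₀] [IsDiscreteValuationRing R₀] [Algebra R₀ F]
  [IsFractionRing R₀ F]
  (R : Type*) [CommRing R] [IsDomain R] [IsDiscreteValuationRing R] [Algebra R L]
  [IsFractionRing R L]
  [Algebra R₀ R] [Algebra R₀ L] [IsScalarTower R₀ R L] [IsScalarTower R₀ F L]

/-- **(d) in p1's form, `E₀(L)^D = ι E₀(F)`**: a `Gal(L/F)`-fixed point of `E(L)` lies in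
`E₀(L)` iff it is the image of a point of `E₀(F)`. For the fixed `T₀ ∈ E₀(L)` produced by
`exists_mem_goodReductionSubgroup_add_pow_smul` this gives `T₀ = ι t₀`, `t₀ ∈ E₀(K_v)`.
Silverman, *AEC* VII.2, VIII.§1; Jetchev 2008, proof of Prop. 4.1. [folklore] -/
theorem mem_goodReductionSubgroup_iff_exists_of_forall_smul_eq [IsGalois F L]
    [IsLocalHom (algebraMap R₀ R)] [(W.baseChange F).IsMinimal R₀] [(W.baseChange L).IsMinimal R]
    {Q : (W.baseChange L).toAffine.Point} (hQ : ∀ σ : L ≃ₐ[F] L, σ • Q = Q) :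
    Q ∈ (W.baseChange L).goodReductionSubgroup R ↔
      ∃ P ∈ (W.baseChange F).goodReductionSubgroup R₀,
        Affine.Point.baseChange (W' := W.toAffine) F L P = Q := by
  obtain ⟨P, rfl⟩ := exists_baseChange_eq_of_forall_smul_eq W L Q hQ
  rw [baseChange_mem_goodReductionSubgroup_iff W L R₀ R P]
  refine ⟨fun hP ↦ ⟨P, hP, rfl⟩, ?_⟩
  rintro ⟨P', hP', hPP'⟩
  rwa [← Affine.Point.map_injective _ hPP']

end Galois

end Summit.BirchSwinnertonDyer.Rank1Residual.X11b.Three.JetchevKummer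

end
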